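import Mathlib
import Literature.Analysis.Complex.PickFunctionsProofsDisc
import HarnessLib

/-!
# A positive harmonic function vanishing on the circle off one point is a multiple of the Poisson kernel

Topic `Literature/Analysis/Complex` (classical potential theory on the unit disc). The uniqueness
statement used to identify the limit in Chelkak–Smirnov's Theorem 3.13 ("the nonnegative harmonic
limit `H` vanishes on `∂Ω ∖ {a}`, hence is proportional to the Poisson kernel `P(·; a)`",
D. Chelkak, S. Smirnov, Adv. Math. 228 (2011), proof of Thm. 3.13) and in many similar places:

> **Theorem (`eq_mul_poissonKernel_of_tendsto_zero`).** Let `h ≥ 0` be harmonic on the open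
> unit disc and suppose `h(w) → 0` as `w → q` inside the disc, for every point `q ≠ p` of the
> unit circle. Then `h = m · P(·, p)` for some constant `m ≥ 0`, where
> `P(w, p) = (1 - |w|²)/|p - w|²` is Mathlib's `poissonKernel 0 w p`.

(e.g. S. Axler, P. Bourdon, W. Ramey, *Harmonic Function Theory* (2001), Thm. 6.19 with
Cor. 6.12; J. Garnett, D. Marshall, *Harmonic Measure* (2005), Ch. I, Exercise 4.) Proof: by the
Herglotz–Riesz theorem (tree: `exists_measure_herglotz_riesz`, applied to the holomorphic `F`
with `Re F = h` given by Mathlib's `HarmonicOnNhd.exists_analyticOnNhd_ball_re_eq`)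
`h(w) = ∫ P(w, ζ) dν(ζ)` for a finite positive measure `ν` on the circle
(`exists_measure_eq_integral_poissonKernel`). The kernel bound
`P((1-s)ζ₀, ζ) ≥ 1/(4s)` for `|ζ - ζ₀| ≤ s` (`le_poissonKernel_of_dist_le`) gives
`ν(B̄(ζ₀, s)) ≤ 4s · h((1-s)ζ₀)` (`measure_closedBall_le`); on a compact arc `K ∌ p` the
boundary hypothesis is uniform (`exists_forall_le_of_tendsto_zero`), and covering `K` by
`≤ 2π/s + 2` such balls centred on `K` (`exists_near_angle`) yields `ν(K) ≤ (8π + 8)ε` for every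
`ε`, so `ν(K) = 0` (`measure_eq_zero_of_tendsto_zero`); exhausting the circle minus `p` by compact
arcs, `ν` is carried by `{p}` and `h = ν(𝕊) · P(·, p)`.

Everything is proved, [folklore].
-/

noncomputable section

namespace Literature.Analysis.Complex

open _root_.Complex Metric Set Filter MeasureTheory InnerProductSpace
open scoped Topology Real

/-! ### The Poisson kernel of the unit disc -/

/-- `P(w, ζ) = (|ζ|² - |w|²)/|ζ - w|²` (Mathlib's `poissonKernel` at centre `0`). [folklore] -/
theorem poissonKernel_zero_eq (w ζ : ℂ) :
    poissonKernel 0 w ζ = (‖ζ‖ ^ 2 - ‖w‖ ^ 2) / ‖ζ - w‖ ^ 2 := by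
  rw [poissonKernel_def]; simp

/-- `P(w, ζ) ≥ 0` for `|w| < 1 = |ζ|`. [folklore] -/
theorem poissonKernel_zero_nonneg {w ζ : ℂ} (hw : ‖w‖ < 1) (hζ : ‖ζ‖ = 1) :
    0 ≤ poissonKernel 0 w ζ := by
  rw [poissonKernel_zero_eq, hζ]
  refine div_nonneg ?_ (sq_nonneg _)
  nlinarith [norm_nonneg w]

/-- Continuity of `ζ ↦ P(w, ζ)` on the circle (`|w| < 1`). [folklore] -/
theorem continuous_poissonKernel_sphere {w : ℂ} (hw : ‖w‖ < 1) :
    Continuous fun ζ : sphere (0 : ℂ) 1 => poissonKernel 0 w ζ := by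
  have hne : ∀ ζ : sphere (0 : ℂ) 1, (ζ : ℂ) - w ≠ 0 := by
    intro ζ h
    have hζ : ‖(ζ : ℂ)‖ = 1 := mem_sphere_zero_iff_norm.1 ζ.2
    rw [sub_eq_zero] at h
    rw [h] at hζ; linarith
  simp_rw [poissonKernel_zero_eq]
  refine Continuous.div (by fun_prop) (by fun_prop) fun ζ => ?_
  exact pow_ne_zero 2 (norm_ne_zero_iff.2 (hne ζ))

/-- **Kernel lower bound near the boundary point below the pole**: for `|ζ₀| = |ζ| = 1`,
`0 < s < 1` and `|ζ - ζ₀| ≤ s`, `P((1-s)ζ₀, ζ) ≥ 1/(4s)` (numerator `1 - (1-s)² ≥ s`,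
denominator `|ζ - (1-s)ζ₀|² ≤ (2s)²`). [folklore] -/
theorem le_poissonKernel_of_dist_le {ζ₀ ζ : ℂ} (hζ₀ : ‖ζ₀‖ = 1) (hζ : ‖ζ‖ = 1) {s : ℝ}
    (hs0 : 0 < s) (hs1 : s < 1) (hnear : dist ζ ζ₀ ≤ s) :
    1 / (4 * s) ≤ poissonKernel 0 (((1 - s : ℝ) : ℂ) * ζ₀) ζ := by
  rw [poissonKernel_zero_eq, hζ, norm_mul, norm_real, Real.norm_eq_abs, abs_of_pos (by linarith),
    hζ₀, mul_one]
  have hden : ‖ζ - ((1 - s : ℝ) : ℂ) * ζ₀‖ ≤ 2 * s := by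
    have h1 : ζ - ((1 - s : ℝ) : ℂ) * ζ₀ = (ζ - ζ₀) + ((s : ℝ) : ℂ) * ζ₀ := by push_cast; ring
    rw [h1]
    calc ‖(ζ - ζ₀) + ((s : ℝ) : ℂ) * ζ₀‖ ≤ ‖ζ - ζ₀‖ + ‖((s : ℝ) : ℂ) * ζ₀‖ := norm_add_le _ _
      _ = dist ζ ζ₀ + s := by
          rw [dist_eq_norm, norm_mul, norm_real, Real.norm_eq_abs, abs_of_pos hs0, hζ₀, mul_one]
      _ ≤ 2 * s := by linarith
  have hden0 : 0 < ‖ζ - ((1 - s : ℝ) : ℂ) * ζ₀‖ := by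
    have : ‖((1 - s : ℝ) : ℂ) * ζ₀‖ < ‖ζ‖ := by
      rw [norm_mul, norm_real, Real.norm_eq_abs, abs_of_pos (by linarith), hζ₀, hζ]; linarith
    have hne : ζ - ((1 - s : ℝ) : ℂ) * ζ₀ ≠ 0 := by
      intro h; rw [sub_eq_zero] at h; rw [h] at this; exact lt_irrefl _ this
    exact norm_pos_iff.2 hne
  rw [div_le_div_iff₀ (by positivity) (by positivity)]
  have h2 : ‖ζ - ((1 - s : ℝ) : ℂ) * ζ₀‖ ^ 2 ≤ (2 * s) ^ 2 := pow_le_pow_left₀ hden0.le hden 2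
  nlinarith

/-! ### Poisson representation of a nonnegative harmonic function -/

/-- **Herglotz–Riesz for harmonic functions**: a nonnegative harmonic function on the unit disc is
the Poisson integral of a finite positive measure on the circle. (Mathlib writes `h = Re F` with
`F` holomorphic; the tree's `exists_measure_herglotz_riesz` represents `F`.) [folklore] -/
theorem exists_measure_eq_integral_poissonKernel {h : ℂ → ℝ} (hh : HarmonicOnNhd h (ball 0 1))
    (h0 : ∀ w ∈ ball (0 : ℂ) 1, 0 ≤ h w) :
    ∃ ν : Measure (sphere (0 : ℂ) 1), IsFiniteMeasure ν ∧ ∀ w ∈ ball (0 : ℂ) 1,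
      h w = ∫ ζ, poissonKernel 0 w (ζ : ℂ) ∂ν := by
  obtain ⟨F, hF, hFre⟩ := hh.exists_analyticOnNhd_ball_re_eq
  obtain ⟨ν, hν, hrep⟩ := exists_measure_herglotz_riesz hF.differentiableOn
    (fun w hw => by
      have e : (F w).re = h w := hFre hw
      rw [e]; exact h0 w hw)
  refine ⟨ν, hν, fun w hw => ?_⟩
  have e : (F w).re = h w := hFre hw
  rw [← e, hrep w hw]
  simp only [add_re, mul_re, I_re, ofReal_re, zero_mul, I_im, ofReal_im, mul_zero, sub_zero,
    zero_add]
  have hint : Integrable (fun ζ : sphere (0 : ℂ) 1 => ((ζ : ℂ) + w) / ((ζ : ℂ) - w)) ν :=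
    (continuous_restrict_herglotz_kernel hw).integrable_of_hasCompactSupport
      (HasCompactSupport.of_compactSpace _)
  have key := integral_re hint
  simp only [RCLike.re_to_complex] at key
  rw [← key]
  refine integral_congr_ae (Eventually.of_forall fun ζ => ?_)
  simp only
  rw [poissonKernel_eq_re_herglotzRieszKernel]
  simp [herglotzRieszKernel_def]

/-- **Mass of small boundary balls**: if `h = ∫ P(·, ζ) dν`, then for `|ζ₀| = 1` and
`0 < s < 1`, `ν{ζ : |ζ - ζ₀| ≤ s} ≤ 4s · h((1-s)ζ₀)`. [folklore] -/
theorem measure_closedBall_le {ν : Measure (sphere (0 : ℂ) 1)} [IsFiniteMeasure ν] {h : ℂ → ℝ}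
    (hrep : ∀ w ∈ ball (0 : ℂ) 1, h w = ∫ ζ, poissonKernel 0 w (ζ : ℂ) ∂ν) {ζ₀ : ℂ}
    (hζ₀ : ‖ζ₀‖ = 1) {s : ℝ} (hs0 : 0 < s) (hs1 : s < 1) :
    (ν {ζ : sphere (0 : ℂ) 1 | dist (ζ : ℂ) ζ₀ ≤ s}).toReal ≤
      4 * s * h (((1 - s : ℝ) : ℂ) * ζ₀) := by
  set w : ℂ := ((1 - s : ℝ) : ℂ) * ζ₀ with hw_def
  have hw1 : ‖w‖ < 1 := by
    rw [hw_def, norm_mul, norm_real, Real.norm_eq_abs, abs_of_pos (by linarith), hζ₀]; linarith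
  have hw : w ∈ ball (0 : ℂ) 1 := mem_ball_zero_iff.2 hw1
  set B : Set (sphere (0 : ℂ) 1) := {ζ | dist (ζ : ℂ) ζ₀ ≤ s} with hB
  have hBm : MeasurableSet B :=
    measurableSet_le (continuous_subtype_val.dist continuous_const).measurable measurable_const
  -- `∫ 1_B /(4s) ≤ ∫ P(w, ·) = h w`
  have hind : ∀ ζ : sphere (0 : ℂ) 1,
      B.indicator (fun _ => 1 / (4 * s)) ζ ≤ poissonKernel 0 w (ζ : ℂ) := by
    intro ζ
    have hζ : ‖(ζ : ℂ)‖ = 1 := mem_sphere_zero_iff_norm.1 ζ.2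
    by_cases hζB : ζ ∈ B
    · rw [indicator_of_mem hζB]
      exact le_poissonKernel_of_dist_le hζ₀ hζ hs0 hs1 hζB
    · rw [indicator_of_notMem hζB]
      exact poissonKernel_zero_nonneg hw1 hζ
  have hintP : Integrable (fun ζ : sphere (0 : ℂ) 1 => poissonKernel 0 w (ζ : ℂ)) ν :=
    (continuous_poissonKernel_sphere hw1).integrable_of_hasCompactSupport
      (HasCompactSupport.of_compactSpace _)
  have hintI : Integrable (B.indicator fun _ : sphere (0 : ℂ) 1 => (1 / (4 * s) : ℝ)) ν :=
    (integrable_const _).indicator hBm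
  have hle := integral_mono hintI hintP hind
  rw [integral_indicator_const _ hBm, smul_eq_mul, ← hrep w hw] at hle
  have hmeas : Measure.real ν B = (ν B).toReal := rfl
  rw [hmeas] at hle
  have h4s : (0 : ℝ) < 4 * s := by positivity
  calc (ν B).toReal = 4 * s * ((ν B).toReal * (1 / (4 * s))) := by field_simp
    _ ≤ 4 * s * h w := mul_le_mul_of_nonneg_left hle h4s.le

/-! ### From pointwise boundary limits to uniform smallness near a compact arc -/

/-- If `h(w) → 0` as `w → q` inside the disc for every `q` of a compact set `K`, then for every
`ε > 0` there is `t > 0` with `h(w) ≤ ε` whenever `w` is in the disc within `t` of `K`. [folklore] -/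
theorem exists_forall_le_of_tendsto_zero {h : ℂ → ℝ} {K : Set ℂ} (hK : IsCompact K)
    (hlim : ∀ q ∈ K, Tendsto h (𝓝[ball (0 : ℂ) 1] q) (𝓝 0)) {ε : ℝ} (hε : 0 < ε) :
    ∃ t > 0, ∀ w ∈ ball (0 : ℂ) 1, ∀ q ∈ K, dist w q < t → h w ≤ ε := by
  have hr : ∀ q : K, ∃ r > 0, ∀ w ∈ ball (0 : ℂ) 1, dist w q < r → h w ≤ ε := by
    intro q
    obtain ⟨r, hr, hrq⟩ := Metric.tendsto_nhdsWithin_nhds.1 (hlim q q.2) ε hε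
    refine ⟨r, hr, fun w hw hd => ?_⟩
    have := hrq hw hd
    rw [Real.dist_eq, sub_zero] at this
    exact (le_abs_self _).trans this.le
  choose r hr hrq using hr
  obtain ⟨T, hT⟩ := hK.elim_finite_subcover (fun q : K => ball (q : ℂ) (r q / 2))
    (fun q => isOpen_ball) (fun q hq => mem_iUnion.2 ⟨⟨q, hq⟩, mem_ball_self (by linarith [hr ⟨q, hq⟩])⟩)
  by_cases hTne : T.Nonempty
  · refine ⟨T.inf' hTne fun q => r q / 2, ?_, fun w hw q hq hd => ?_⟩
    · rw [gt_iff_lt, Finset.lt_inf'_iff]; intro q _; linarith [hr q]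
    obtain ⟨i, hi⟩ := mem_iUnion.1 (hT hq)
    obtain ⟨hiT, hqi⟩ := mem_iUnion.1 hi
    rw [mem_ball] at hqi
    have hle : T.inf' hTne (fun q => r q / 2) ≤ r i / 2 := Finset.inf'_le _ hiT
    refine hrq i w hw ?_
    calc dist w i ≤ dist w q + dist q i := dist_triangle _ _ _
      _ < r i / 2 + r i / 2 := add_lt_add (lt_of_lt_of_le hd hle) hqi
      _ = r i := by ring
  · refine ⟨1, one_pos, fun w hw q hq hd => ?_⟩
    exfalso
    have := hT hq
    rw [Finset.not_nonempty_iff_eq_empty.1 hTne] at this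
    simp at this

/-! ### Covering the circle by equally spaced points -/

/-- Every point of the unit circle is within `2π/N` of one of the `N + 1` points
`exp(i(-π + 2πj/N))`, `j = 0, …, N`. [folklore] -/
theorem exists_near_angle {N : ℕ} (hN : 0 < N) {ζ : ℂ} (hζ : ‖ζ‖ = 1) :
    ∃ j : ℕ, j ≤ N ∧ dist ζ (exp (I * ((-π + 2 * π * j / N : ℝ) : ℂ))) ≤ 2 * π / N := by
  set θ := arg ζ with hθ
  have hθ1 : -π < θ := neg_pi_lt_arg ζ
  have hθ2 : θ ≤ π := arg_le_pi ζ
  have hζeq : ζ = exp (I * (θ : ℂ)) := by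
    have := norm_mul_exp_arg_mul_I ζ
    rw [hζ, ofReal_one, one_mul, mul_comm] at this
    rw [hθ]; exact this.symm
  have hNr : (0 : ℝ) < N := by exact_mod_cast hN
  set x : ℝ := (θ + π) * N / (2 * π) with hx
  have hx0 : 0 ≤ x := by rw [hx]; exact div_nonneg (mul_nonneg (by linarith) hNr.le) (by positivity)
  set j := ⌊x⌋₊ with hj
  have hjx : (j : ℝ) ≤ x := Nat.floor_le hx0
  have hxj : x < j + 1 := Nat.lt_floor_add_one x
  refine ⟨j, ?_, ?_⟩
  · have hxN : x ≤ N := by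
      rw [hx, div_le_iff₀ (by positivity)]
      nlinarith
    exact_mod_cast hjx.trans hxN
  · -- the angle difference
    set α : ℝ := -π + 2 * π * j / N with hα
    have hdiff1 : 0 ≤ θ - α := by
      rw [hα]
      have : 2 * π * j / N ≤ θ + π := by
        rw [div_le_iff₀ hNr]
        have := mul_le_mul_of_nonneg_left hjx (show (0:ℝ) ≤ 2 * π by positivity)
        rw [hx] at this
        have h2 : 2 * π * ((θ + π) * N / (2 * π)) = (θ + π) * N := by field_simp
        linarith
      linarith
    have hdiff2 : θ - α ≤ 2 * π / N := by
      rw [hα]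
      have : θ + π < 2 * π * (j + 1) / N := by
        rw [lt_div_iff₀ hNr]
        have := mul_lt_mul_of_pos_left hxj (show (0:ℝ) < 2 * π by positivity)
        rw [hx] at this
        have h2 : 2 * π * ((θ + π) * N / (2 * π)) = (θ + π) * N := by field_simp
        linarith
      have h3 : 2 * π * (j + 1) / N = 2 * π * j / N + 2 * π / N := by field_simp
      linarith
    rw [hζeq, dist_eq_norm]
    have hfac : exp (I * (θ : ℂ)) - exp (I * (α : ℂ)) =
        exp (I * (α : ℂ)) * (exp (I * ((θ - α : ℝ) : ℂ)) - 1) := by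
      rw [mul_sub, mul_one, ← Complex.exp_add]
      congr 2
      push_cast; ring
    rw [hfac, norm_mul, Complex.norm_exp_I_mul_ofReal, one_mul]
    calc ‖exp (I * ((θ - α : ℝ) : ℂ)) - 1‖ ≤ ‖θ - α‖ := Real.norm_exp_I_mul_ofReal_sub_one_le
      _ = θ - α := by rw [Real.norm_eq_abs, abs_of_nonneg hdiff1]
      _ ≤ 2 * π / N := hdiff2

/-! ### Vanishing of the representing measure on good arcs -/

/-- **The representing measure vanishes on compact arcs where `h → 0`.** [folklore] -/
theorem measure_eq_zero_of_tendsto_zero {ν : Measure (sphere (0 : ℂ) 1)} [IsFiniteMeasure ν]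
    {h : ℂ → ℝ} (hrep : ∀ w ∈ ball (0 : ℂ) 1, h w = ∫ ζ, poissonKernel 0 w (ζ : ℂ) ∂ν)
    {K : Set ℂ} (hK : IsCompact K) (hKS : K ⊆ sphere (0 : ℂ) 1)
    (hlim : ∀ q ∈ K, Tendsto h (𝓝[ball (0 : ℂ) 1] q) (𝓝 0)) :
    ν {ζ : sphere (0 : ℂ) 1 | (ζ : ℂ) ∈ K} = 0 := by
  classical
  set K' : Set (sphere (0 : ℂ) 1) := {ζ | (ζ : ℂ) ∈ K} with hK'
  -- it suffices to bound the (finite) mass by `(8π + 8) ε` for every `ε > 0`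
  suffices hbound : ∀ ε > 0, (ν K').toReal ≤ (16 * π + 8) * ε by
    have h0 : (ν K').toReal ≤ 0 := by
      by_contra h
      push Not at h
      have := hbound ((ν K').toReal / (2 * (16 * π + 8))) (by positivity)
      have h2 : (16 * π + 8) * ((ν K').toReal / (2 * (16 * π + 8))) = (ν K').toReal / 2 := by
        field_simp
      linarith
    have h1 : (ν K').toReal = 0 := le_antisymm h0 ENNReal.toReal_nonneg
    exact (ENNReal.toReal_eq_zero_iff _).1 h1 |>.resolve_right (measure_ne_top ν K')
  intro ε hε
  obtain ⟨t, ht, htK⟩ := exists_forall_le_of_tendsto_zero hK hlim hε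
  -- the scale `s`
  set s := min (t / 2) (1 / 2) with hs
  have hs0 : 0 < s := lt_min (by positivity) (by norm_num)
  have hs1 : s < 1 := lt_of_le_of_lt (min_le_right _ _) (by norm_num)
  have hst : s < t := lt_of_le_of_lt (min_le_left _ _) (by linarith)
  -- mass of the `s`-balls about points of `K`
  have hball : ∀ ζ₀ ∈ K, (ν {ζ : sphere (0 : ℂ) 1 | dist (ζ : ℂ) ζ₀ ≤ s}).toReal ≤ 4 * s * ε := by
    intro ζ₀ hζ₀
    have hζ₀1 : ‖ζ₀‖ = 1 := mem_sphere_zero_iff_norm.1 (hKS hζ₀)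
    have h1 := measure_closedBall_le hrep hζ₀1 hs0 hs1
    have hw : ((1 - s : ℝ) : ℂ) * ζ₀ ∈ ball (0 : ℂ) 1 := by
      rw [mem_ball, dist_zero_right, norm_mul, norm_real, Real.norm_eq_abs,
        abs_of_pos (by linarith), hζ₀1]; linarith
    have hd : dist (((1 - s : ℝ) : ℂ) * ζ₀) ζ₀ < t := by
      rw [dist_eq_norm]
      have : ((1 - s : ℝ) : ℂ) * ζ₀ - ζ₀ = -(((s : ℝ) : ℂ) * ζ₀) := by push_cast; ring
      rw [this, norm_neg, norm_mul, norm_real, Real.norm_eq_abs, abs_of_pos hs0, hζ₀1, mul_one]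
      exact hst
    have h2 := htK _ hw ζ₀ hζ₀ hd
    calc (ν {ζ : sphere (0 : ℂ) 1 | dist (ζ : ℂ) ζ₀ ≤ s}).toReal
        ≤ 4 * s * h (((1 - s : ℝ) : ℂ) * ζ₀) := h1
      _ ≤ 4 * s * ε := mul_le_mul_of_nonneg_left h2 (by positivity)
  -- the net: `N + 1` equally spaced points, spacing `2π/N ≤ s/2`
  set N := ⌈4 * π / s⌉₊ with hN
  have hNr : 4 * π / s ≤ N := Nat.le_ceil _
  have hN0 : 0 < N := by
    have : (0 : ℝ) < 4 * π / s := by positivity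
    exact_mod_cast this.trans_le hNr
  have hNr' : (0 : ℝ) < N := by exact_mod_cast hN0
  have hspacing : 2 * π / N ≤ s / 2 := by
    rw [div_le_iff₀ hNr']
    have := (div_le_iff₀ hs0).1 hNr
    linarith
  set z : ℕ → ℂ := fun j => exp (I * ((-π + 2 * π * j / N : ℝ) : ℂ)) with hz
  -- centres in `K`
  set good : ℕ → Prop := fun j => ∃ ζ ∈ K, dist ζ (z j) ≤ s / 2 with hgood
  set c : ℕ → ℂ := fun j => if hj : good j then hj.choose else 0 with hc
  have hc_spec : ∀ j, good j → c j ∈ K ∧ dist (c j) (z j) ≤ s / 2 := by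
    intro j hj
    simp only [hc, dif_pos hj]
    exact hj.choose_spec
  set T : ℕ → Set (sphere (0 : ℂ) 1) := fun j =>
    if good j then {ζ | dist (ζ : ℂ) (c j) ≤ s} else ∅ with hT
  -- `K'` is covered by the `T j`, `j ≤ N`
  have hcover : K' ⊆ ⋃ j ∈ Finset.range (N + 1), T j := by
    intro ζ hζ
    have hζ1 : ‖(ζ : ℂ)‖ = 1 := mem_sphere_zero_iff_norm.1 ζ.2
    obtain ⟨j, hjN, hjd⟩ := exists_near_angle hN0 hζ1
    have hgj : good j := ⟨ζ, hζ, hjd.trans hspacing⟩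
    obtain ⟨-, hcj⟩ := hc_spec j hgj
    refine mem_iUnion₂.2 ⟨j, Finset.mem_range.2 (Nat.lt_succ_of_le hjN), ?_⟩
    simp only [hT, if_pos hgj, mem_setOf_eq]
    calc dist (ζ : ℂ) (c j) ≤ dist (ζ : ℂ) (z j) + dist (c j) (z j) := dist_triangle_right _ _ _
      _ ≤ s / 2 + s / 2 := add_le_add (hjd.trans hspacing) hcj
      _ = s := by ring
  -- each `T j` has mass `≤ 4 s ε`
  have hTle : ∀ j, (ν (T j)).toReal ≤ 4 * s * ε := by
    intro j
    by_cases hgj : good j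
    · simp only [hT, if_pos hgj]
      exact hball _ (hc_spec j hgj).1
    · simp only [hT, if_neg hgj, measure_empty, ENNReal.toReal_zero]
      positivity
  -- add up
  have h1 : ν K' ≤ ∑ j ∈ Finset.range (N + 1), ν (T j) :=
    (measure_mono hcover).trans (measure_biUnion_finset_le _ _)
  have h2 : (ν K').toReal ≤ ∑ j ∈ Finset.range (N + 1), (ν (T j)).toReal := by
    rw [← ENNReal.toReal_sum fun j _ => measure_ne_top ν (T j)]
    exact ENNReal.toReal_mono (ENNReal.sum_ne_top.2 fun j _ => measure_ne_top ν (T j)) h1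
  have h3 : ∑ j ∈ Finset.range (N + 1), (ν (T j)).toReal ≤ (N + 1) * (4 * s * ε) := by
    have := Finset.sum_le_sum fun j (_ : j ∈ Finset.range (N + 1)) => hTle j
    simpa using this
  -- `(N + 1) 4 s ε ≤ (8π + 8) ε` since `N < 4π/s + 1` and `s ≤ 1/2`
  have hN1 : (N : ℝ) < 4 * π / s + 1 := Nat.ceil_lt_add_one (by positivity)
  have h4 : ((N : ℝ) + 1) * (4 * s * ε) ≤ (16 * π + 8) * ε := by
    have hs2 : s ≤ 1 / 2 := min_le_right _ _
    have h5 : ((N : ℝ) + 1) * s ≤ 4 * π + 2 * s := by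
      have := mul_le_mul_of_nonneg_right hN1.le hs0.le
      have h6 : (4 * π / s + 1) * s = 4 * π + s := by field_simp
      nlinarith
    calc ((N : ℝ) + 1) * (4 * s * ε) = 4 * ε * (((N : ℝ) + 1) * s) := by ring
      _ ≤ 4 * ε * (4 * π + 2 * s) := mul_le_mul_of_nonneg_left h5 (by positivity)
      _ ≤ 4 * ε * (4 * π + 2) := by
          refine mul_le_mul_of_nonneg_left ?_ (by positivity); linarith
      _ = (16 * π + 8) * ε := by ring
  linarith

/-! ### The theorem -/

/-- **A nonnegative harmonic function on the disc tending to zero at every boundary point but one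
is a multiple of the Poisson kernel**: if `h ≥ 0` is harmonic on `ball 0 1` and `h(w) → 0` as
`w → q` within the disc for every `q` of the circle other than `p`, then
`h(w) = m (1 - |w|²)/|p - w|²` for some `m ≥ 0` (the interesting case is `|p| = 1`; if `p` is not
on the circle the hypothesis covers the whole circle and `m = 0`). [folklore] -/
theorem eq_mul_poissonKernel_of_tendsto_zero {h : ℂ → ℝ} (hh : HarmonicOnNhd h (ball 0 1))
    (h0 : ∀ w ∈ ball (0 : ℂ) 1, 0 ≤ h w) {p : ℂ}
    (hlim : ∀ q : ℂ, ‖q‖ = 1 → q ≠ p → Tendsto h (𝓝[ball (0 : ℂ) 1] q) (𝓝 0)) :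
    ∃ m : ℝ, 0 ≤ m ∧ ∀ w ∈ ball (0 : ℂ) 1, h w = m * poissonKernel 0 w p := by
  obtain ⟨ν, hν, hrep⟩ := exists_measure_eq_integral_poissonKernel hh h0
  -- `ν` is carried by `{p}`
  have hnull : ν {ζ : sphere (0 : ℂ) 1 | (ζ : ℂ) ≠ p} = 0 := by
    set K : ℕ → Set ℂ := fun n => sphere (0 : ℂ) 1 ∩ {ζ | 1 / ((n : ℝ) + 1) ≤ dist ζ p} with hK
    have hKc : ∀ n, IsCompact (K n) := fun n =>
      (isCompact_sphere 0 1).inter_right (isClosed_le continuous_const (continuous_id.dist continuous_const))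
    have hKS : ∀ n, K n ⊆ sphere (0 : ℂ) 1 := fun n => inter_subset_left
    have hKn : ∀ n, ν {ζ : sphere (0 : ℂ) 1 | (ζ : ℂ) ∈ K n} = 0 := by
      intro n
      refine measure_eq_zero_of_tendsto_zero hrep (hKc n) (hKS n) fun q hq => hlim q ?_ ?_
      · exact mem_sphere_zero_iff_norm.1 hq.1
      · intro hqp
        have := hq.2
        simp only [mem_setOf_eq, hqp, dist_self] at this
        have : (0 : ℝ) < 1 / ((n : ℝ) + 1) := by positivity
        linarith
    have hsub : {ζ : sphere (0 : ℂ) 1 | (ζ : ℂ) ≠ p} ⊆ ⋃ n, {ζ : sphere (0 : ℂ) 1 | (ζ : ℂ) ∈ K n} := by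
      intro ζ hζ
      have hd : 0 < dist (ζ : ℂ) p := dist_pos.2 hζ
      obtain ⟨n, hn⟩ := exists_nat_one_div_lt hd
      refine mem_iUnion.2 ⟨n, ?_⟩
      simp only [mem_setOf_eq, hK, mem_inter_iff]
      exact ⟨ζ.2, hn.le⟩
    exact measure_mono_null hsub (measure_iUnion_null hKn)
  have hae : ∀ᵐ (ζ : sphere (0 : ℂ) 1) ∂ν, (ζ : ℂ) = p := by
    rw [ae_iff]
    simpa using hnull
  refine ⟨(ν (univ : Set (sphere (0 : ℂ) 1))).toReal, ENNReal.toReal_nonneg, fun w hw => ?_⟩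
  rw [hrep w hw]
  have : (fun ζ : sphere (0 : ℂ) 1 => poissonKernel 0 w (ζ : ℂ)) =ᵐ[ν] fun _ => poissonKernel 0 w p := by
    filter_upwards [hae] with ζ hζ
    rw [hζ]
  rw [integral_congr_ae this, integral_const, smul_eq_mul]
  rfl

end Literature.Analysis.Complex
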